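import Mathlib
import HarnessLib
import Summits.HubbardSuperconductivity.HubbardSuperconductivity.Theorems.KLProgrammeKLRegimeEngineTowerRemeasureWtAllUniform
import Summits.HubbardSuperconductivity.HubbardSuperconductivity.Theorems.KLProgrammeKLRegimeEngineTowerRemeasureLevBase
import Summits.HubbardSuperconductivity.HubbardSuperconductivity.Theorems.KLProgrammeKLRegimeEngineTowerInstRemeasureLevFBase

/-!
# Route `KLProgramme` — crux K3 ENGINE (stmt-HubbardSuperconductivity-20437 `KLRegimeEngineV17F2`), stub (b) v2, THE WEIGHTED HALF «(b)-WT4»: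
# W3a — THE RE-BASED WEIGHTED RE-MEASUREMENT ON THE FLOW FRAME: the input `𝒱_{dk}` of block `k ≥ 2` at `(F_{dk−1}, rate j)` against the BASE `𝒱_d` and the
# born increments `Δ_{k′}`, `1 ≤ k′ < k`, in absolute units and in track-`0` floor kit units
# (cell gate-hubbard-kl, seat hubbard-kl-k3c3-p2 g17; weighted twin of …TowerRemeasureLevBase (p4 g19) + …TowerInstRemeasureLevFBase §1–§3 at `t = 0`, on p4 g17's
#  m-uniform window-free weighted jump row `klWtPinnedSumAt_jump_le_klEng_flow_all_uniform`; E1 may rename or supersede)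

The bridge `hR` of W1 (`klTowerBornWtAt_le_law_of_inputs_base_tokX`, …TowerWtLawBaseTokX) asks, at every block `k ≥ 2`, for the measured weighted profile of
`𝒱_{dk} = 𝒱_d + Σ_{1≤k′<k} Δ_{k′}` at `(F_{dk−1}, rate j)` from the law on the born arrays of the blocks `2 … k`.  The ONE weighted jump row of the tree that is
window-free and m-uniform (p4 g17, File D′) re-measures ANY momentum-conserving `T` from a coarse family `F_J` to a finer `F_{J′}` at the flow frame `K_n` at
the cost `C₁·C₂^m·(2^{J′−J})^{m−1}` in degree `m+1` (one leg determined by conservation); applied to `T := 𝒱_d` (`J = d−1`) and `T := Δ_{k′}` (`J = dk′`) with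
ONE pair of constants it gives the summed row, and the track-`0` floor units turn the jump factor into the pure gain `(2^{jump})^{3−p}` (`jumpW_div_klLevRatioF_eq`:
`2^{2p−2}/(8^p/32) = (2^{p−3})⁻¹`):
* §1 `klWtPinnedSumAt_klTowerInput_le_base` (pointwise subadditivity along `𝒱_{dk} = 𝒱_d + Σ_{1≤k′<k} Δ_{k′}`), `klTowerMeasWtAt_le_of_summand_bounds_base`;
* §2 **`klTowerMeasWtAt_le_base_add_sum_bornWtAt_klEng_uniform (R c″)`** — on `K_n`, `2 ≤ d`, `2 ≤ k`, `dk−1 ≤ n`, rate `j ≥ dk−1`, base bound `N_b` of the rate-`j`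
  weighted pinned sums of `𝒱_d` at `F_{d−1}` in degree `m+1`:
  `klTowerMeasWtAt … d k j (m+1) ≤ C₁C₂^m·(2^{(dk−1)−(d−1)})^{m−1}·N_b + Σ_{1≤k′<k} C₁C₂^m·(2^{dk−1−dk′})^{m−1}·klTowerBornWtAt … d k′ j (m+1)`;
* §3 `jumpW_div_klLevRatioF_eq`, `bornSummandW_div_klLevUnitF_eq`, `baseSummandW_div_klLevUnitF_eq` (the summands in floor kit units, `p ≥ 3`);
* §4 **`klTowerMeasWtAt_div_le_kitSum_base_klEng (R c″)`** — §2 at `m+1 = 2p` divided by `klLevUnitF β M 0 p (dk−1)`: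
  `μ ≤ C₁C₂^{2p−1}·( ((2^{p−3})⁻¹)^{d(k−1)}·N_b/unitF(p,d−1) + Σ_{1≤k′<k} 2^{p−3}·((2^d)⁻¹)^{(p−3)(k−k′)}·klTowerBornWtAt … d k′ j (2p)/unitF(p,dk′) )`.
Everything is proved; no definitions; nothing about the model is asserted; nothing asserts (b), (ℓ), any stub, K3 or superconductivity.
References: BGM 2006 §2.8 (2.76), (2.82)–(2.84), (2.88)–(2.90), (2.93)–(2.98) [cite: BenfattoGiulianiMastropietro2006].
-/

noncomputable section

namespace Summit.HubbardSuperconductivity.HubbardSuperconductivity.Theorems.EngineV8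

set_option linter.dupNamespace false -- summit = problem name (single-conjunct summit), D-0017

open Classical
open Real Finset Literature.MathematicalPhysics.QuantumLattice Literature.Probability.LatticeModels GrassmannAlgebra
open Literature.MathematicalPhysics.QuantumLattice.FermiRG
open Summit.HubbardSuperconductivity.HubbardSuperconductivity.Theorems.KLProgrammeLegKernels
open Summit.HubbardSuperconductivity.HubbardSuperconductivity.Theorems.KLRegimeSplit
open Summit.HubbardSuperconductivity.HubbardSuperconductivity.Theorems.DispersionFlow
open Summit.HubbardSuperconductivity.HubbardSuperconductivity.Theorems.KLRegimeWick

variable {L M : ℕ} [NeZero L] [NeZero M]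

/-! ## §1 The input of block `k ≥ 1` decomposed from the base `𝒱_d`, weighted rate-decoupled carrier -/

omit [NeZero M] in
/-- **Pointwise form, weighted, re-based**: the rate-`j` weighted pinned sum of `𝒱_{dk}` at `F_{dk−1}` is at most that of the base `𝒱_d` plus those of
`Δ_{k′}`, `1 ≤ k′ < k`. -/
theorem klWtPinnedSumAt_klTowerInput_le_base {β : ℝ} (hβ : 0 ≤ β) (U μ : ℝ) (K : TrigPolyC4v) (d : ℕ) {k : ℕ} (hk : 1 ≤ k) (j m : ℕ) (q : Fin m)
    (w : SpaceTimeIdx L M × SectorLeg (sectorCount (d * k - 1))) :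
    klWtPinnedSumAt L M β μ K (d * k - 1) j m (klTowerInput L M β U μ K d k) q w ≤
      klWtPinnedSumAt L M β μ K (d * k - 1) j m (klTowerInput L M β U μ K d 1) q w +
        ∑ k' ∈ Ico 1 k, klWtPinnedSumAt L M β μ K (d * k - 1) j m (klTowerIncr L M β U μ K d k') q w := by
  rw [klTowerInput_eq_one_add_sum β U μ K d hk]
  exact (klWtPinnedSumAt_add_le hβ μ K _ j m _ _ q w).trans (by gcongr; exact klWtPinnedSumAt_sum_le hβ μ K _ j m _ _ q w)

omit [NeZero M] in
/-- **`μ k ≤` re-measured BASE bound `+ Σ_{1≤k′<k}` re-measured increment bounds** (weighted rate-decoupled carrier, `k ≥ 1`). -/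
theorem klTowerMeasWtAt_le_of_summand_bounds_base {β : ℝ} (hβ : 0 ≤ β) (U μ : ℝ) (K : TrigPolyC4v) (d : ℕ) {k : ℕ} (hk : 1 ≤ k) (j m : ℕ)
    {V₀ : ℝ} {W : ℕ → ℝ} (hV0 : 0 ≤ V₀) (hW0 : ∀ k' ∈ Ico 1 k, 0 ≤ W k')
    (hV : ∀ (q : Fin m) (w : SpaceTimeIdx L M × SectorLeg (sectorCount (d * k - 1))),
      klWtPinnedSumAt L M β μ K (d * k - 1) j m (klTowerInput L M β U μ K d 1) q w ≤ V₀)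
    (hW : ∀ k' ∈ Ico 1 k, ∀ (q : Fin m) (w : SpaceTimeIdx L M × SectorLeg (sectorCount (d * k - 1))),
      klWtPinnedSumAt L M β μ K (d * k - 1) j m (klTowerIncr L M β U μ K d k') q w ≤ W k') :
    klTowerMeasWtAt L M β U μ K d k j m ≤ V₀ + ∑ k' ∈ Ico 1 k, W k' := by
  have hRHS : 0 ≤ V₀ + ∑ k' ∈ Ico 1 k, W k' := add_nonneg hV0 (sum_nonneg fun k' hk' => hW0 k' hk')
  unfold klTowerMeasWtAt
  rcases isEmpty_or_nonempty (Fin m × (SpaceTimeIdx L M × SectorLeg (sectorCount (d * k - 1)))) with h | h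
  · rw [Real.iSup_of_isEmpty]; exact hRHS
  · exact ciSup_le fun qw => (klWtPinnedSumAt_klTowerInput_le_base hβ U μ K d hk j m qw.1 qw.2).trans
      (add_le_add (hV qw.1 qw.2) (sum_le_sum fun k' hk' => hW k' hk' qw.1 qw.2))

/-! ## §2 The summed re-based row on the flow frame, m-uniform constants -/

omit [NeZero L] [NeZero M] in
/-- **THE RE-BASED WEIGHTED `hμ` ROW ON THE FLOW FRAME IN ABSOLUTE UNITS, m-UNIFORM** (weighted twin of `klTowerMeasLev_le_base_add_sum_bornLev_klEng_uniform`,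
one pair of constants for the base and the increments): for every `m`, `2 ≤ d`, `2 ≤ k`, `dk − 1 ≤ n`, rate `j ≥ dk − 1` and base bound `N_b ≥ 0` of the rate-`j`
weighted pinned sums of `𝒱_d` at `F_{d−1}` in degree `m+1`,
`klTowerMeasWtAt … d k j (m+1) ≤ C₁C₂^m·(2^{(dk−1)−(d−1)})^{m−1}·N_b + Σ_{1≤k′<k} C₁C₂^m·(2^{dk−1−dk′})^{m−1}·klTowerBornWtAt … d k′ j (m+1)`.
[cite: BenfattoGiulianiMastropietro2006, §2.8 (2.76), (2.82)-(2.84), (2.88)-(2.90)] -/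
theorem klTowerMeasWtAt_le_base_add_sum_bornWtAt_klEng_uniform (R : RenConsts) (c'' : ℝ) (hc'' : 0 ≤ c'') :
    ∃ C₁ C₂ : ℝ, 0 < C₁ ∧ 0 < C₂ ∧ (R.WF2 → ∃ c₃' : ℝ, 0 < c₃' ∧ ∃ U₀' : ℝ, 0 < U₀' ∧ ∀ m : ℕ,
      ∀ (G : GeoConsts) (P : SplitConsts) (Q : EngConsts) (cc : ℝ), 0 < cc → cc ≤ klEngC₃6 P R → cc ≤ c₃' →
      ∀ μ ∈ klWindowC, ∀ U : ℝ, 0 < U → U ≤ min (klEngU₀3 P R cc) (1 / (R.Gfr 3 + 1)) → U ≤ U₀' → c'' * U ≤ 1 →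
      ∀ β : ℝ, klBetaMin ≤ β → β ≤ Real.exp (cc / U ^ 2) →
      ∀ (L M : ℕ) [NeZero L] [NeZero M], klEngL₃ β U ≤ L → klEngM₃ β U L ≤ M →
      ∀ n : ℕ, 1 ≤ n → n ≤ nScales β + 1 → IsKLRegime U cc (-(n : ℤ)) → HistP klPredsV17F2 L M G P Q R β U μ 0 n →
        (∀ m', 1 ≤ m' → m' < n → FlowPieceOscAt L M c'' β U μ m') →
      ∀ d k : ℕ, 2 ≤ d → 2 ≤ k → d * k - 1 ≤ n → ∀ j : ℕ, d * k - 1 ≤ j → ∀ Nb : ℝ, 0 ≤ Nb →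
        (∀ (q : Fin (m + 1)) (w' : SpaceTimeIdx L M × SectorLeg (sectorCount (d - 1))),
          klWtPinnedSumAt L M β μ (klFlowFrameU L M β U μ n) (d - 1) j (m + 1) (klTowerInput L M β U μ (klFlowFrameU L M β U μ n) d 1) q w' ≤ Nb) →
        klTowerMeasWtAt L M β U μ (klFlowFrameU L M β U μ n) d k j (m + 1) ≤
          C₁ * C₂ ^ m * ((2 : ℝ) ^ (d * k - 1 - (d - 1))) ^ (m - 1) * Nb +
            ∑ k' ∈ Ico 1 k, C₁ * C₂ ^ m * ((2 : ℝ) ^ (d * k - 1 - d * k')) ^ (m - 1) *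
              klTowerBornWtAt L M β U μ (klFlowFrameU L M β U μ n) d k' j (m + 1)) := by
  obtain ⟨C₁, C₂, hC₁, hC₂, h⟩ := klWtPinnedSumAt_jump_le_klEng_flow_all_uniform R c'' hc''
  refine ⟨C₁, C₂, hC₁, hC₂, fun hR2 => ?_⟩
  obtain ⟨c₃, hc₃, U₀, hU₀, h'⟩ := h hR2
  refine ⟨c₃, hc₃, U₀, hU₀, ?_⟩
  intro m G P Q cc hcc hcc6 hcc₃' μ hμ U hU hUle hU₀' hcU β hβmin hβc L M _ _ hL3 hM3 n hn1 hnN hkl hhist hosc d k hd hk2 hkn j hj Nb hNb0 hNb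
  have hβ : 0 < β := KLRegimeSplit.pos_of_klBetaMin_le hβmin
  set K : TrigPolyC4v := klFlowFrameU L M β U μ n with hK
  have hd2k : d * 2 ≤ d * k := Nat.mul_le_mul_left d hk2
  refine klTowerMeasWtAt_le_of_summand_bounds_base (L := L) (M := M) hβ.le U μ K d (by omega : 1 ≤ k) j (m + 1)
    (W := fun k' => C₁ * C₂ ^ m * ((2 : ℝ) ^ (d * k - 1 - d * k')) ^ (m - 1) * klTowerBornWtAt L M β U μ K d k' j (m + 1))
    (by positivity) (fun k' _ => mul_nonneg (by positivity) (klTowerBornWtAt_nonneg hβ.le U μ K d k' j (m + 1))) ?_ ?_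
  · -- the base `𝒱_d`, coarse family `F_{d−1}`, momentum-conserving
    intro q w
    exact h' m G P Q cc hcc hcc6 hcc₃' μ hμ U hU hUle hU₀' hcU β hβmin hβc L M hL3 hM3 n hn1 hnN hkl hhist hosc (d - 1) (d * k - 1) (by omega) hkn
      (klTowerInput L M β U μ K d 1) (fun m' X hX => klEffectiveAction_momentumConserving β U μ K klE0 _ m' X hX) j hj q w Nb hNb0
      (fun w' => hNb q w')
  · -- the increments `Δ_{k′}`, coarse family `F_{dk′}`
    intro k' hk' q w
    have hk'k : k' < k := (mem_Ico.1 hk').2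
    exact h' m G P Q cc hcc hcc6 hcc₃' μ hμ U hU hUle hU₀' hcU β hβmin hβc L M hL3 hM3 n hn1 hnN hkl hhist hosc (d * k') (d * k - 1)
      (block_jump_le hd hk'k) hkn (klTowerIncr L M β U μ K d k') (fun m' X hX => klTowerIncr_momentumConserving β U μ K d k' m' X hX) j hj q w
      (klTowerBornWtAt L M β U μ K d k' j (m + 1)) (klTowerBornWtAt_nonneg hβ.le U μ K d k' j (m + 1))
      (fun w' => klWtPinnedSumAt_le_klTowerBornWtAt β U μ K d k' j (m + 1) q w')

/-! ## §3 Powers of `2`: the jump factor against the track-`0` floor unit ratio -/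

omit [NeZero L] [NeZero M] in
/-- **The weighted jump/unit identity**: `2^{2p−2}·32·2^{p−3} = 8^p` (`3 ≤ p`). -/
theorem jumpW_identity {p : ℕ} (h3 : 3 ≤ p) : (2 : ℝ) ^ (2 * p - 2) * 32 * (2 : ℝ) ^ (p - 3) = 8 ^ p := by
  have h32 : (32 : ℝ) = 2 ^ 5 := by norm_num
  have h8 : (8 : ℝ) ^ p = 2 ^ (3 * p) := by rw [pow_mul]; norm_num
  rw [h32, h8, ← pow_add, ← pow_add]
  congr 1
  omega

omit [NeZero L] [NeZero M] in
/-- **The weighted jump factor over the track-`0` floor unit ratio is a pure gain**: `2^{2p−2} / klLevRatioF 0 p = (2^{p−3})⁻¹` (`3 ≤ p`). -/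
theorem jumpW_div_klLevRatioF_eq {p : ℕ} (h3 : 3 ≤ p) : (2 : ℝ) ^ (2 * p - 2) / klLevRatioF 0 p = ((2 : ℝ) ^ (p - 3))⁻¹ := by
  have hid := jumpW_identity h3
  unfold klLevRatioF
  rw [show klLevGain 0 = 0 from rfl, pow_zero, mul_one]
  have h8 : (0 : ℝ) < 8 ^ p := by positivity
  have he0 : (0 : ℝ) < 2 ^ (p - 3) := by positivity
  field_simp
  linear_combination hid

/-- **One born summand in track-`0` floor kit units**: for `k′ < k`, `1 ≤ d`, `3 ≤ p`,
`(2^{dk−1−dk′})^{2p−2}·klTowerBornWtAt … d k′ j (2p) / klLevUnitF … 0 p (dk−1) = 2^{p−3}·((2^d)⁻¹)^{(p−3)(k−k′)}·(klTowerBornWtAt … d k′ j (2p) / klLevUnitF … 0 p (dk′))`. -/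
theorem bornSummandW_div_klLevUnitF_eq {β : ℝ} (hβ : 0 < β) (U μ : ℝ) (K : TrigPolyC4v) {d k k' p : ℕ} (j : ℕ) (hd : 1 ≤ d) (hk : k' < k) (h3 : 3 ≤ p) :
    ((2 : ℝ) ^ (d * k - 1 - d * k')) ^ (2 * p - 2) * klTowerBornWtAt L M β U μ K d k' j (2 * p) / klLevUnitF β M 0 p (d * k - 1) =
      (2 : ℝ) ^ (p - 3) * (((2 : ℝ) ^ d)⁻¹) ^ ((p - 3) * (k - k')) *
        (klTowerBornWtAt L M β U μ K d k' j (2 * p) / klLevUnitF β M 0 p (d * k')) := by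
  have hu0 : 0 < klLevUnitF β M 0 p (d * k') := klLevUnitF_pos hβ 0 p _
  have hr0 : 0 < klLevRatioF 0 p := klLevRatioF_pos 0 p
  obtain ⟨Δ, hΔ⟩ : ∃ Δ : ℕ, d * k - 1 = d * k' + Δ := ⟨d * k - 1 - d * k', by
    have : d * k' + d ≤ d * k := by rw [← Nat.mul_succ]; exact Nat.mul_le_mul_left d hk
    omega⟩
  have hΔ1 : Δ + 1 = d * (k - k') := by
    have : d * (k - k') = d * k - d * k' := Nat.mul_sub d k k'
    have : d * k' + d ≤ d * k := by rw [← Nat.mul_succ]; exact Nat.mul_le_mul_left d hk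
    omega
  have hΔ' : d * k - 1 - d * k' = Δ := by omega
  rw [hΔ', hΔ, klLevUnitF_add, ← pow_mul, mul_comm Δ, pow_mul]
  rw [show ((2 : ℝ) ^ (2 * p - 2)) ^ Δ * klTowerBornWtAt L M β U μ K d k' j (2 * p) / (klLevUnitF β M 0 p (d * k') * klLevRatioF 0 p ^ Δ) =
      ((2 : ℝ) ^ (2 * p - 2) / klLevRatioF 0 p) ^ Δ * (klTowerBornWtAt L M β U μ K d k' j (2 * p) / klLevUnitF β M 0 p (d * k')) by
    rw [div_pow]; field_simp]
  rw [jumpW_div_klLevRatioF_eq h3, inv_pow_eq_mul_inv_pow_succ (by positivity) Δ, hΔ1, ← inv_pow, ← pow_mul, ← inv_pow, ← pow_mul]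
  congr 3
  ring

omit [NeZero L] in
/-- **The base summand in track-`0` floor kit units**: for `1 ≤ d`, `1 ≤ k`, `3 ≤ p`,
`(2^{(dk−1)−(d−1)})^{2p−2}·N_b / klLevUnitF … 0 p (dk−1) = ((2^{p−3})⁻¹)^{d(k−1)}·(N_b / klLevUnitF … 0 p (d−1))`. -/
theorem baseSummandW_div_klLevUnitF_eq {β : ℝ} (hβ : 0 < β) {d k p : ℕ} (hd : 1 ≤ d) (hk : 1 ≤ k) (h3 : 3 ≤ p) (Nb : ℝ) :
    ((2 : ℝ) ^ (d * k - 1 - (d - 1))) ^ (2 * p - 2) * Nb / klLevUnitF β M 0 p (d * k - 1) =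
      (((2 : ℝ) ^ (p - 3))⁻¹) ^ (d * (k - 1)) * (Nb / klLevUnitF β M 0 p (d - 1)) := by
  have hu0 : 0 < klLevUnitF β M 0 p (d - 1) := klLevUnitF_pos hβ 0 p _
  have hr0 : 0 < klLevRatioF 0 p := klLevRatioF_pos 0 p
  have hdk : d * (k - 1) = d * k - d := by rw [Nat.mul_sub, Nat.mul_one]
  have hdle : d ≤ d * k := Nat.le_mul_of_pos_right d (by omega)
  have hΔ : d * k - 1 - (d - 1) = d * (k - 1) := by omega
  have hsplit : d * k - 1 = (d - 1) + d * (k - 1) := by omega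
  rw [hΔ, hsplit, klLevUnitF_add, ← pow_mul, mul_comm (d * (k - 1)), pow_mul, ← jumpW_div_klLevRatioF_eq h3, div_pow]
  field_simp

/-! ## §4 The re-based weighted re-measurement row in track-`0` floor kit units -/

omit [NeZero L] [NeZero M] in
/-- **THE RE-BASED WEIGHTED `hμ` SUMMANDS IN FLOOR KIT UNITS, ON THE FLOW FRAME** (`d ≥ 2`, `k ≥ 2`, `3 ≤ p`, rate `j ≥ dk−1`, base bound `N_b` at `(F_{d−1}, rate j)`
in degree `2p`): `klTowerMeasWtAt … d k j (2p) / klLevUnitF β M 0 p (dk−1) ≤ C₁·C₂^{2p−1}·( ((2^{p−3})⁻¹)^{d(k−1)}·N_b/klLevUnitF β M 0 p (d−1) +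
Σ_{1≤k′<k} 2^{p−3}·((2^d)⁻¹)^{(p−3)(k−k′)}·klTowerBornWtAt … d k′ j (2p)/klLevUnitF β M 0 p (dk′) )`. [cite: BenfattoGiulianiMastropietro2006, §2.8 (2.83), (2.93)-(2.98)] -/
theorem klTowerMeasWtAt_div_le_kitSum_base_klEng (R : RenConsts) (c'' : ℝ) (hc'' : 0 ≤ c'') :
    ∃ C₁ C₂ : ℝ, 0 < C₁ ∧ 0 < C₂ ∧ (R.WF2 → ∃ c₃' : ℝ, 0 < c₃' ∧ ∃ U₀' : ℝ, 0 < U₀' ∧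
      ∀ (G : GeoConsts) (P : SplitConsts) (Q : EngConsts) (cc : ℝ), 0 < cc → cc ≤ klEngC₃6 P R → cc ≤ c₃' →
      ∀ μ ∈ klWindowC, ∀ U : ℝ, 0 < U → U ≤ min (klEngU₀3 P R cc) (1 / (R.Gfr 3 + 1)) → U ≤ U₀' → c'' * U ≤ 1 →
      ∀ β : ℝ, klBetaMin ≤ β → β ≤ Real.exp (cc / U ^ 2) →
      ∀ (L M : ℕ) [NeZero L] [NeZero M], klEngL₃ β U ≤ L → klEngM₃ β U L ≤ M →
      ∀ n : ℕ, 1 ≤ n → n ≤ nScales β + 1 → IsKLRegime U cc (-(n : ℤ)) → HistP klPredsV17F2 L M G P Q R β U μ 0 n →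
        (∀ m', 1 ≤ m' → m' < n → FlowPieceOscAt L M c'' β U μ m') →
      ∀ d k : ℕ, 2 ≤ d → 2 ≤ k → d * k - 1 ≤ n → ∀ j : ℕ, d * k - 1 ≤ j → ∀ p : ℕ, 3 ≤ p → ∀ Nb : ℝ, 0 ≤ Nb →
        (∀ (q : Fin (2 * p)) (w' : SpaceTimeIdx L M × SectorLeg (sectorCount (d - 1))),
          klWtPinnedSumAt L M β μ (klFlowFrameU L M β U μ n) (d - 1) j (2 * p) (klTowerInput L M β U μ (klFlowFrameU L M β U μ n) d 1) q w' ≤ Nb) →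
        klTowerMeasWtAt L M β U μ (klFlowFrameU L M β U μ n) d k j (2 * p) / klLevUnitF β M 0 p (d * k - 1) ≤
          C₁ * C₂ ^ (2 * p - 1) *
            ((((2 : ℝ) ^ (p - 3))⁻¹) ^ (d * (k - 1)) * (Nb / klLevUnitF β M 0 p (d - 1)) +
              ∑ k' ∈ Ico 1 k, (2 : ℝ) ^ (p - 3) * (((2 : ℝ) ^ d)⁻¹) ^ ((p - 3) * (k - k')) *
                (klTowerBornWtAt L M β U μ (klFlowFrameU L M β U μ n) d k' j (2 * p) / klLevUnitF β M 0 p (d * k')))) := by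
  obtain ⟨C₁, C₂, hC₁, hC₂, h⟩ := klTowerMeasWtAt_le_base_add_sum_bornWtAt_klEng_uniform R c'' hc''
  refine ⟨C₁, C₂, hC₁, hC₂, fun hR2 => ?_⟩
  obtain ⟨c₃, hc₃, U₀, hU₀, h'⟩ := h hR2
  refine ⟨c₃, hc₃, U₀, hU₀, ?_⟩
  intro G P Q cc hcc hcc6 hcc₃' μ hμ U hU hUle hU₀' hcU β hβmin hβc L M _ _ hL3 hM3 n hn1 hnN hkl hhist hosc d k hd hk2 hkn j hj p h3 Nb hNb0 hNb
  have hβ : 0 < β := KLRegimeSplit.pos_of_klBetaMin_le hβmin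
  set K : TrigPolyC4v := klFlowFrameU L M β U μ n with hK
  have hu : 0 < klLevUnitF β M 0 p (d * k - 1) := klLevUnitF_pos hβ 0 p _
  have hNb' : ∀ (q : Fin (2 * p - 1 + 1)) (w' : SpaceTimeIdx L M × SectorLeg (sectorCount (d - 1))),
      klWtPinnedSumAt L M β μ K (d - 1) j (2 * p - 1 + 1) (klTowerInput L M β U μ K d 1) q w' ≤ Nb := by
    rw [show 2 * p - 1 + 1 = 2 * p by omega]; exact hNb
  have hrow := h' (2 * p - 1) G P Q cc hcc hcc6 hcc₃' μ hμ U hU hUle hU₀' hcU β hβmin hβc L M hL3 hM3 n hn1 hnN hkl hhist hosc d k hd hk2 hkn j hj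
    Nb hNb0 hNb'
  rw [show 2 * p - 1 + 1 = 2 * p by omega, show 2 * p - 1 - 1 = 2 * p - 2 by omega] at hrow
  rw [div_le_iff₀ hu]
  have hborn : ∀ k' ∈ Ico 1 k, C₁ * C₂ ^ (2 * p - 1) * ((2 : ℝ) ^ (d * k - 1 - d * k')) ^ (2 * p - 2) * klTowerBornWtAt L M β U μ K d k' j (2 * p) =
      C₁ * C₂ ^ (2 * p - 1) * ((2 : ℝ) ^ (p - 3) * (((2 : ℝ) ^ d)⁻¹) ^ ((p - 3) * (k - k')) *
        (klTowerBornWtAt L M β U μ K d k' j (2 * p) / klLevUnitF β M 0 p (d * k'))) * klLevUnitF β M 0 p (d * k - 1) := by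
    intro k' hk'
    have hk'k : k' < k := (mem_Ico.1 hk').2
    have eq := bornSummandW_div_klLevUnitF_eq (L := L) (M := M) hβ U μ K j (by omega : 1 ≤ d) hk'k h3 (p := p)
    rw [div_eq_iff hu.ne'] at eq
    rw [mul_assoc (C₁ * C₂ ^ (2 * p - 1)), mul_assoc (C₁ * C₂ ^ (2 * p - 1)), eq]
  have hbs : C₁ * C₂ ^ (2 * p - 1) * ((2 : ℝ) ^ (d * k - 1 - (d - 1))) ^ (2 * p - 2) * Nb =
      C₁ * C₂ ^ (2 * p - 1) * ((((2 : ℝ) ^ (p - 3))⁻¹) ^ (d * (k - 1)) * (Nb / klLevUnitF β M 0 p (d - 1))) * klLevUnitF β M 0 p (d * k - 1) := by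
    have eq := baseSummandW_div_klLevUnitF_eq (M := M) hβ (d := d) (k := k) (by omega) (by omega) h3 Nb
    rw [div_eq_iff hu.ne'] at eq
    rw [mul_assoc (C₁ * C₂ ^ (2 * p - 1)), mul_assoc (C₁ * C₂ ^ (2 * p - 1)), eq]
  rw [sum_congr rfl hborn, hbs, ← sum_mul, ← mul_sum] at hrow
  refine hrow.trans (le_of_eq ?_)
  ring

end Summit.HubbardSuperconductivity.HubbardSuperconductivity.Theorems.EngineV8

end
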